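import Summits.QuantumFields.YangMills.Theorems.FradkinShenkerFlowSusceptibilityToPoincareFineClauseMono
import Summits.QuantumFields.YangMills.Theorems.FradkinShenkerFlowSusceptibilityToPoincareHaarResample
import Summits.QuantumFields.YangMills.Theorems.SusceptibilityToPoincare.Negative.HeatBathExchange

/-!
# Rider `stub_heatBathSensitivity_of` (G1b) of the line `rg-variance-cascade` (crux `SusceptibilityToPoincare`)

Route `FradkinShenkerFlow` of `YangMills`, crux item `stmt-QuantumFields-9441`
(`Summit.QuantumFields.YangMills.Theses.FradkinShenkerFlow.SusceptibilityToPoincare`, FS ⇒ UP),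
registered skeleton `Cruxes/SusceptibilityToPoincare/Lines/rg_variance_cascade.lean`, rider G1b of
the necessity package "UP ⇒ TerminalPoincare": **the lattice glue — the heat-bath form of the
posterior-mean function is dominated by the coarse single-coordinate residuals.**

For the 4D torus of side `N = 2S+1`, the Wilson measure `μ = wilsonMeasure r.ρ β`, a block size
`B ≥ 1`, a pin strength `s`, the von Mises–Fisher one-link law `ν = Haar.tilted (s · Re tr r.ρ)`,
the product noise `π = ν^{⊗E}` over the coarse edges `E`, the straight transporters
`h_e(U) = BalabanAveraging.link N B (BlockMean.rep 0) U e` and a bounded measurable `g` on coarse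
configurations, put `H(U) = ∫ g(w · h(U)) dπ(w)`.  Taking as HYPOTHESES the abstract
one-coordinate sensitivity bound (N5, `stub_tiltedShift_sq_le`) and the uniqueness of the coarse
straight path through a fine link (N3, `stub_straightPath_unique`), we prove, with
`K = 4 e^{4 |s| B_ρ} · B` (`B_ρ` a bound on `|Re tr r.ρ|`), for every `S`, `g` and every family
`c_e` of bounded measurable functions not depending on the coordinate `e`:

  `Σ_ℓ ∫ dμ(U) ∫ dν_ℓ^U(y) (H(U) − H(U[ℓ ↦ y]))² ≤ K · Σ_e ∫ dμ(U) ∫ dπ(w) (g(w·h(U)) − c_e(w·h(U)))²`,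

`ν_ℓ^U = Haar.tilted (−β S_W(U[ℓ ↦ ·]))` the one-link heat-bath law.

## Proof

* LOCALITY (`HeatBathSensitivity.link_update_of_not_mem`): `h_e` is the transporter along the
  straight path `path e` of `width ≤ B` fine links (`BalabanAveraging.link_rep_zero`), so it does
  not see a resampled link `ℓ ∉ path e` (`BalabanAveraging.transport_congr`).
* SHIFT (`HeatBathSensitivity.sq_sub_le_sum_mul`): if `ℓ ∈ path e`, then by N3 no other coarse
  transporter changes, and `h_e(U[ℓ ↦ y]) = δ h_e(U)` with `δ = h_e(U[ℓ ↦ y]) h_e(U)⁻¹`, so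
  `H(U[ℓ ↦ y]) = ∫ g((w[e ↦ w_e δ]) · h(U)) dπ(w)` is a one-coordinate multiplicative shift of the
  noise, and N5 gives `(H(U) − H(U[ℓ ↦ y]))² ≤ 4 e^{4 B_ψ} R_e(U)`,
  `R_e(U) = ∫ (g(w·h(U)) − c_e(w·h(U)))² dπ(w)`; if `ℓ` lies on no coarse path the difference
  vanishes.  Hence pointwise `(H(U) − H(U[ℓ ↦ y]))² ≤ Σ_e [ℓ ∈ path e] 4 e^{4B_ψ} R_e(U)`.
* INTEGRATION (`HeatBathSensitivity.integral_integral_le`): the bound does not depend on `y`;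
  `ν_ℓ^U` is a probability measure (`Negative.isProbabilityMeasure_heatBath`) and `U ↦ R_e(U)` is
  measurable (parametric integral of a jointly measurable integrand,
  `BalabanAveraging.measurable_link`) and bounded, hence `μ`-integrable; `integral_mono_of_nonneg`
  twice (no measurability of the heat-bath integrand is needed).
* COUNTING (`HeatBathSensitivity.sum_sum_mul_le`): exchanging the sums, each coarse edge `e` is
  charged once for every fine link on its path, at most `width ≤ B` times
  (`HeatBathSensitivity.length_pathEdges`, `BalabanAveraging.width_le`).

The analytic part is proved abstractly (`HeatBathSensitivity.sum_integral_sq_sub_le`): any finite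
measure `μ`, any probability kernels `κ_ℓ`, any resampling maps `T`, any "transporters" `h` with
the locality/uniqueness/length properties; the registered stub instantiates it on the torus.
-/

noncomputable section

open MeasureTheory ProbabilityTheory
open Literature.MathematicalPhysics.QuantumFieldTheory

namespace Summit.QuantumFields.YangMills.Theorems.SusceptibilityToPoincare.RgVarianceCascade

namespace HeatBathSensitivity

/-! ### Combinatorics of straight paths -/

section Combinatorics

/-- A lattice path with `k` steps has `k` edges. [folklore] -/
theorem length_pathEdges {d N : ℕ} (c : Site d N) (is : List (Fin d)) :
    (Literature.MathematicalPhysics.QuantumLattice.pathEdges c is).length = is.length := by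
  induction is generalizing c with
  | nil => rfl
  | cons i is ih =>
    rw [BalabanAveraging.pathEdges_cons', List.length_cons, List.length_cons, ih]

/-- The number of elements of a finite type lying on a list is at most its length. [folklore] -/
theorem card_filter_mem_le {α : Type*} [Fintype α] [DecidableEq α] (l : List α) :
    (Finset.univ.filter fun a => a ∈ l).card ≤ l.length := by
  have h : (Finset.univ.filter fun a => a ∈ l) = l.toFinset := by
    ext a
    simp only [Finset.mem_filter, Finset.mem_univ, true_and, List.mem_toFinset]
  rw [h]
  exact List.toFinset_card_le l

/-- **Double sum with bounded column sums**: if `t ≥ 0` and `Σ_ℓ a ℓ e ≤ M` for every `e`, then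
`Σ_ℓ Σ_e a ℓ e · t e ≤ M · Σ_e t e`. [folklore] -/
theorem sum_sum_mul_le {L E : Type*} [Fintype L] [Fintype E] {a : L → E → ℝ} {t : E → ℝ}
    (ht : ∀ e, 0 ≤ t e) {M : ℝ} (ha : ∀ e, ∑ ℓ, a ℓ e ≤ M) :
    ∑ ℓ, ∑ e, a ℓ e * t e ≤ M * ∑ e, t e := by
  rw [Finset.sum_comm, Finset.mul_sum]
  refine Finset.sum_le_sum fun e _ => ?_
  rw [← Finset.sum_mul]
  exact mul_le_mul_of_nonneg_right (ha e) (ht e)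

/-- **Locality of the straight transporter**: the block link `h_e(U)` (straight transporter of
`width` steps from the corner of `e.1`, `BalabanAveraging.link_rep_zero`) does not change when a
fine link off its path is resampled (`BalabanAveraging.transport_congr`). [folklore] -/
theorem link_update_of_not_mem {d N B : ℕ} [NeZero B] {G : Type*} [Group G] [MeasurableSpace G]
    (U : GaugeConfig d N G) (ℓ : Edge d N) (y : G) (e : Edge d (BalabanAveraging.blockSide N B))
    (h : ℓ ∉ Literature.MathematicalPhysics.QuantumLattice.pathEdges (BalabanAveraging.corner N B e.1)
      (List.replicate (BalabanAveraging.width N B e.1 e.2) e.2)) :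
    BalabanAveraging.link N B (BalabanAveraging.BlockMean.rep 0) (Function.update U ℓ y) e =
      BalabanAveraging.link N B (BalabanAveraging.BlockMean.rep 0) U e := by
  rw [BalabanAveraging.link_rep_zero, BalabanAveraging.link_rep_zero]
  exact BalabanAveraging.transport_congr fun e' he' =>
    Function.update_of_ne (ne_of_mem_of_not_mem he' h) y U

end Combinatorics

/-! ### The one-coordinate shift: pointwise bound -/

section Pointwise

/-- **Pointwise sensitivity bound through a one-coordinate shift.**  Let `h₀, h₁ : E → K` be two
families of "transporters" that agree off the set `P` (`¬P e → h₁ e = h₀ e`), with `P` holding at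
most at one `e` (uniqueness).  If for every `e` with `P e` the shift bound
`(∫ g(w·h₀) dπ − ∫ g((w[e ↦ w_e δ])·h₀) dπ)² ≤ a e · R e` holds for all `δ`, with `a, R ≥ 0`, then
`(∫ g(w·h₀) dπ − ∫ g(w·h₁) dπ)² ≤ Σ_e a e · R e`: at the unique `e` with `P e` one has
`w·h₁ = (w[e ↦ w_e δ])·h₀` with `δ = h₁ e (h₀ e)⁻¹`; if there is none, `h₁ = h₀`. [folklore] -/
theorem sq_sub_le_sum_mul {E K : Type*} [Fintype E] [DecidableEq E] [Group K] [MeasurableSpace K]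
    (π : Measure (E → K)) (g : (E → K) → ℝ) (h₀ h₁ : E → K) (P : E → Prop)
    (hloc : ∀ e, ¬P e → h₁ e = h₀ e) (huniq : ∀ e e', P e → P e' → e = e')
    {a R : E → ℝ} (ha : ∀ e, 0 ≤ a e) (hR : ∀ e, 0 ≤ R e)
    (h5 : ∀ e, P e → ∀ δ : K, (∫ w, g (fun e' => w e' * h₀ e') ∂π -
        ∫ w, g (fun e' => Function.update w e (w e * δ) e' * h₀ e') ∂π) ^ 2 ≤ a e * R e) :
    (∫ w, g (fun e' => w e' * h₀ e') ∂π - ∫ w, g (fun e' => w e' * h₁ e') ∂π) ^ 2 ≤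
      ∑ e, a e * R e := by
  have hnn : ∀ e, 0 ≤ a e * R e := fun e => mul_nonneg (ha e) (hR e)
  by_cases hex : ∃ e, P e
  · obtain ⟨e, he⟩ := hex
    have key : ∀ w : E → K, (fun e' => w e' * h₁ e') =
        fun e' => Function.update w e (w e * (h₁ e * (h₀ e)⁻¹)) e' * h₀ e' := by
      intro w
      funext e'
      by_cases hee : e' = e
      · subst hee
        rw [Function.update_self, mul_assoc, inv_mul_cancel_right]
      · rw [Function.update_of_ne hee, hloc e' fun hP => hee (huniq e' e hP he)]
    have hint : ∫ w, g (fun e' => w e' * h₁ e') ∂π =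
        ∫ w, g (fun e' => Function.update w e (w e * (h₁ e * (h₀ e)⁻¹)) e' * h₀ e') ∂π :=
      integral_congr_ae (ae_of_all _ fun w => congrArg g (key w))
    rw [hint]
    exact (h5 e he _).trans (Finset.single_le_sum (fun e' _ => hnn e') (Finset.mem_univ e))
  · have key : h₁ = h₀ := funext fun e => hloc e fun hP => hex ⟨e, hP⟩
    rw [key, sub_self, zero_pow two_ne_zero]
    exact Finset.sum_nonneg fun e _ => hnn e

/-- **Integrating a pointwise bound that does not depend on the resampled coordinate**: for
probability measures `κ x` and `0 ≤ F x y ≤ b x` with `b` integrable,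
`∫ (∫ F x y dκ_x(y)) dμ(x) ≤ ∫ b dμ` (`integral_mono_of_nonneg` twice — no measurability of `F`
is needed). [folklore] -/
theorem integral_integral_le {X Y : Type*} [MeasurableSpace X] [MeasurableSpace Y]
    {μ : Measure X} {κ : X → Measure Y} (hκ : ∀ x, IsProbabilityMeasure (κ x))
    {F : X → Y → ℝ} {b : X → ℝ} (hF0 : ∀ x y, 0 ≤ F x y) (hFb : ∀ x y, F x y ≤ b x)
    (hb : Integrable b μ) :
    ∫ x, ∫ y, F x y ∂κ x ∂μ ≤ ∫ x, b x ∂μ := by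
  refine integral_mono_of_nonneg (ae_of_all _ fun x => integral_nonneg (hF0 x)) hb
    (ae_of_all _ fun x => ?_)
  haveI := hκ x
  have h := integral_mono_of_nonneg (μ := κ x) (ae_of_all _ (hF0 x)) (integrable_const (b x))
    (ae_of_all _ (hFb x))
  simpa only [integral_const, probReal_univ, one_smul] using h

end Pointwise

/-! ### The abstract heat-bath sensitivity bound -/

section Abstract

/-- **Abstract heat-bath sensitivity bound.**  Data: a finite measure `μ` on `X` (fine fields),
probability measures `κ ℓ x` on `Y` (one-link resampling laws) and resampling maps `T x ℓ y`, a
measurable group `K` with a right-invariant probability measure `lam` and a bounded measurable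
tilt `ψ` (`|ψ| ≤ B_ψ`), "transporters" `h x e ∈ K` measurable in `x`, and for each coarse
coordinate `e` a list `path e` of fine links with: LOCALITY (`ℓ ∉ path e → h (T x ℓ y) e = h x e`),
UNIQUENESS (a fine link lies on at most one path) and LENGTH `≤ B`.  Then, GIVEN the abstract
one-coordinate sensitivity bound N5 (hypothesis), for bounded measurable `g` and bounded
measurable `c e` not depending on the coordinate `e`, with `π = (lam.tilted ψ)^{⊗E}` and
`H(x) = ∫ g(w · h(x)) dπ(w)`:
`Σ_ℓ ∫∫ (H(x) − H(T x ℓ y))² dκ_ℓ^x(y) dμ(x) ≤ 4 e^{4B_ψ} B · Σ_e ∫∫ (g(w·h(x)) − c_e(w·h(x)))² dπ dμ`.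
[folklore] -/
theorem sum_integral_sq_sub_le
    (hN5 : ∀ (ι : Type) [Fintype ι] [DecidableEq ι] (K : Type) [Group K] [MeasurableSpace K]
      [MeasurableMul₂ K] (lam : Measure K) [IsProbabilityMeasure lam] [lam.IsMulRightInvariant]
      (ψ : K → ℝ), Measurable ψ → ∀ (Bψ : ℝ), (∀ k, |ψ k| ≤ Bψ) →
      ∀ (Φ : (ι → K) → ℝ), Measurable Φ → (∃ M : ℝ, ∀ w, |Φ w| ≤ M) →
      ∀ (c : (ι → K) → ℝ), Measurable c → (∃ M : ℝ, ∀ w, |c w| ≤ M) →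
      ∀ (e : ι), (∀ w y, c (Function.update w e y) = c w) → ∀ (δ : K),
      (∫ w, Φ w ∂Measure.pi (fun _ : ι => lam.tilted ψ) -
          ∫ w, Φ (Function.update w e (w e * δ)) ∂Measure.pi (fun _ : ι => lam.tilted ψ)) ^ 2 ≤
        4 * Real.exp (4 * Bψ) * ∫ w, (Φ w - c w) ^ 2 ∂Measure.pi (fun _ : ι => lam.tilted ψ))
    {X Y L : Type*} [MeasurableSpace X] [MeasurableSpace Y] [Fintype L] [DecidableEq L]
    {E K : Type} [Fintype E] [DecidableEq E] [Group K] [MeasurableSpace K] [MeasurableMul₂ K]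
    (lam : Measure K) [IsProbabilityMeasure lam] [lam.IsMulRightInvariant]
    {ψ : K → ℝ} (hψm : Measurable ψ) {Bψ : ℝ} (hψB : ∀ k, |ψ k| ≤ Bψ)
    (μ : Measure X) [IsFiniteMeasure μ] (κ : L → X → Measure Y)
    (hκ : ∀ ℓ x, IsProbabilityMeasure (κ ℓ x)) (T : X → L → Y → X)
    (h : X → E → K) (hm : ∀ e, Measurable fun x => h x e) (path : E → List L)
    (hloc : ∀ x ℓ y e, ℓ ∉ path e → h (T x ℓ y) e = h x e)
    (huniq : ∀ e e' ℓ, ℓ ∈ path e → ℓ ∈ path e' → e = e')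
    {B : ℕ} (hlen : ∀ e, (path e).length ≤ B)
    {g : (E → K) → ℝ} (hg : Measurable g) (hgM : ∃ M : ℝ, ∀ V, |g V| ≤ M)
    {c : E → (E → K) → ℝ} (hc : ∀ e, Measurable (c e)) (hcM : ∀ e, ∃ M : ℝ, ∀ V, |c e V| ≤ M)
    (hcu : ∀ e V y, c e (Function.update V e y) = c e V) :
    ∑ ℓ, ∫ x, ∫ y, ((∫ w, g (fun e => w e * h x e) ∂Measure.pi (fun _ : E => lam.tilted ψ)) -
        (∫ w, g (fun e => w e * h (T x ℓ y) e) ∂Measure.pi (fun _ : E => lam.tilted ψ))) ^ 2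
        ∂κ ℓ x ∂μ ≤
      4 * Real.exp (4 * Bψ) * B * ∑ e, ∫ x, ∫ w, (g (fun e' => w e' * h x e') -
        c e (fun e' => w e' * h x e')) ^ 2 ∂Measure.pi (fun _ : E => lam.tilted ψ) ∂μ := by
  set π : Measure (E → K) := Measure.pi (fun _ : E => lam.tilted ψ) with hπ
  set C₄ : ℝ := 4 * Real.exp (4 * Bψ) with hC₄
  have hC₄0 : 0 ≤ C₄ := by positivity
  obtain ⟨Mg, hMg⟩ := hgM
  -- measurability of the unshear `w ↦ w · h(x)`, separately and jointly
  have hsh : ∀ x, Measurable fun (w : E → K) (e : E) => w e * h x e := fun x =>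
    measurable_pi_lambda _ fun e => (measurable_pi_apply e).mul_const _
  have hsh2 : Measurable fun (p : X × (E → K)) (e : E) => p.2 e * h p.1 e :=
    measurable_pi_lambda _ fun e =>
      ((measurable_pi_apply e).comp measurable_snd).mul ((hm e).comp measurable_fst)
  -- the residuals `R e x = ∫ (g(w·h(x)) − c_e(w·h(x)))² dπ(w)`: nonnegative, measurable, bounded
  have hR0 : ∀ e x, 0 ≤ ∫ w, (g (fun e' => w e' * h x e') - c e (fun e' => w e' * h x e')) ^ 2 ∂π :=
    fun e x => integral_nonneg fun w => sq_nonneg _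
  have hRm : ∀ e, Measurable fun x =>
      ∫ w, (g (fun e' => w e' * h x e') - c e (fun e' => w e' * h x e')) ^ 2 ∂π := fun e => by
    have hf : Measurable fun p : X × (E → K) =>
        (g (fun e' => p.2 e' * h p.1 e') - c e (fun e' => p.2 e' * h p.1 e')) ^ 2 :=
      ((hg.comp hsh2).sub ((hc e).comp hsh2)).pow_const 2
    exact (hf.stronglyMeasurable.integral_prod_right' (ν := π)).measurable
  have hRi : ∀ e, Integrable (fun x =>
      ∫ w, (g (fun e' => w e' * h x e') - c e (fun e' => w e' * h x e')) ^ 2 ∂π) μ := fun e => by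
    obtain ⟨Mc, hMc⟩ := hcM e
    refine Integrable.of_bound (hRm e).aestronglyMeasurable ((Mg + Mc) ^ 2 * π.real Set.univ)
      (ae_of_all _ fun x => norm_integral_le_of_norm_le_const (ae_of_all _ fun w => ?_))
    rw [Real.norm_eq_abs, abs_of_nonneg (sq_nonneg _), ← sq_abs]
    exact pow_le_pow_left₀ (abs_nonneg _) ((abs_sub _ _).trans (add_le_add (hMg _) (hMc _))) 2
  -- `c_e(w · h(x))` does not depend on the coordinate `w_e`
  have hcu' : ∀ (e : E) (x : X) (w : E → K) (y : K),
      c e (fun e' => Function.update w e y e' * h x e') = c e (fun e' => w e' * h x e') := by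
    intro e x w y
    have hupd : (fun e' => Function.update w e y e' * h x e') =
        Function.update (fun e' => w e' * h x e') e (y * h x e) := by
      funext e'
      by_cases hee : e' = e
      · subst hee
        rw [Function.update_self, Function.update_self]
      · rw [Function.update_of_ne hee, Function.update_of_ne hee]
    rw [hupd, hcu]
  -- POINTWISE: `(H(x) − H(T x ℓ y))² ≤ Σ_e [ℓ ∈ path e] C₄ R e x`
  have hpt : ∀ (ℓ : L) (x : X) (y : Y),
      ((∫ w, g (fun e => w e * h x e) ∂π) - (∫ w, g (fun e => w e * h (T x ℓ y) e) ∂π)) ^ 2 ≤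
        ∑ e, (if ℓ ∈ path e then C₄ else 0) *
          ∫ w, (g (fun e' => w e' * h x e') - c e (fun e' => w e' * h x e')) ^ 2 ∂π := by
    intro ℓ x y
    refine sq_sub_le_sum_mul π g (h x) (h (T x ℓ y)) (fun e => ℓ ∈ path e)
      (fun e he => hloc x ℓ y e he) (fun e e' he he' => huniq e e' ℓ he he')
      (fun e => by positivity) (fun e => hR0 e x) fun e he δ => ?_
    rw [if_pos he]
    obtain ⟨Mc, hMc⟩ := hcM e
    exact hN5 E K lam ψ hψm Bψ hψB (fun w => g (fun e' => w e' * h x e')) (hg.comp (hsh x))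
      ⟨Mg, fun w => hMg _⟩ (fun w => c e (fun e' => w e' * h x e')) ((hc e).comp (hsh x))
      ⟨Mc, fun w => hMc _⟩ e (hcu' e x) δ
  -- INTEGRATION, link by link
  have hlink : ∀ ℓ : L,
      ∫ x, ∫ y, ((∫ w, g (fun e => w e * h x e) ∂π) -
          (∫ w, g (fun e => w e * h (T x ℓ y) e) ∂π)) ^ 2 ∂κ ℓ x ∂μ ≤
        ∑ e, (if ℓ ∈ path e then C₄ else 0) *
          ∫ x, ∫ w, (g (fun e' => w e' * h x e') - c e (fun e' => w e' * h x e')) ^ 2 ∂π ∂μ := by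
    intro ℓ
    have hbi : Integrable (fun x => ∑ e, (if ℓ ∈ path e then C₄ else 0) *
        ∫ w, (g (fun e' => w e' * h x e') - c e (fun e' => w e' * h x e')) ^ 2 ∂π) μ :=
      integrable_finsetSum _ fun e _ => (hRi e).const_mul _
    calc ∫ x, ∫ y, ((∫ w, g (fun e => w e * h x e) ∂π) -
          (∫ w, g (fun e => w e * h (T x ℓ y) e) ∂π)) ^ 2 ∂κ ℓ x ∂μ
        ≤ ∫ x, ∑ e, (if ℓ ∈ path e then C₄ else 0) *
            ∫ w, (g (fun e' => w e' * h x e') - c e (fun e' => w e' * h x e')) ^ 2 ∂π ∂μ :=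
          integral_integral_le (hκ ℓ) (fun x y => sq_nonneg _) (fun x y => hpt ℓ x y) hbi
      _ = ∑ e, ∫ x, (if ℓ ∈ path e then C₄ else 0) *
            ∫ w, (g (fun e' => w e' * h x e') - c e (fun e' => w e' * h x e')) ^ 2 ∂π ∂μ :=
          integral_finsetSum _ fun e _ => (hRi e).const_mul _
      _ = _ := Finset.sum_congr rfl fun e _ => integral_const_mul _ _
  -- COUNTING: each coarse edge is charged at most `B` times
  have hcol : ∀ e : E, ∑ ℓ : L, (if ℓ ∈ path e then C₄ else 0) ≤ C₄ * B := fun e =>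
    calc ∑ ℓ : L, (if ℓ ∈ path e then C₄ else 0)
        = ∑ _ℓ ∈ Finset.univ.filter (fun ℓ : L => ℓ ∈ path e), C₄ := (Finset.sum_filter _ _).symm
      _ = ((Finset.univ.filter (fun ℓ : L => ℓ ∈ path e)).card : ℝ) * C₄ := by
          rw [Finset.sum_const, nsmul_eq_mul]
      _ ≤ (B : ℝ) * C₄ :=
          mul_le_mul_of_nonneg_right
            (Nat.cast_le.2 ((card_filter_mem_le (path e)).trans (hlen e))) hC₄0
      _ = C₄ * B := mul_comm _ _
  calc ∑ ℓ, ∫ x, ∫ y, ((∫ w, g (fun e => w e * h x e) ∂π) -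
          (∫ w, g (fun e => w e * h (T x ℓ y) e) ∂π)) ^ 2 ∂κ ℓ x ∂μ
      ≤ ∑ ℓ, ∑ e, (if ℓ ∈ path e then C₄ else 0) *
          ∫ x, ∫ w, (g (fun e' => w e' * h x e') - c e (fun e' => w e' * h x e')) ^ 2 ∂π ∂μ :=
        Finset.sum_le_sum fun ℓ _ => hlink ℓ
    _ ≤ C₄ * B * ∑ e, ∫ x, ∫ w, (g (fun e' => w e' * h x e') -
          c e (fun e' => w e' * h x e')) ^ 2 ∂π ∂μ :=
        sum_sum_mul_le (fun e => integral_nonneg (hR0 e)) hcol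

end Abstract

end HeatBathSensitivity

/-! ### The registered stub -/

/-- Rider G1b `stub_heatBathSensitivity_of`: **the heat-bath form of the posterior-mean function is
dominated by the coarse single-coordinate residuals** — GIVEN the abstract one-coordinate
sensitivity bound (N5, first hypothesis) and the uniqueness of the coarse straight path through a
fine link (N3, second hypothesis), for every compact `G`, lattice representation `r`, real `β`,
block size `B ≥ 1` and pin strength `s` there is `K` (namely `4 e^{4|s|B_ρ} B`, `B_ρ` a bound on
`|Re tr r.ρ|`) such that for every side `2S+1`, bounded measurable `g` and bounded measurable
`c_e` not depending on the coordinate `e`, with `π = (Haar.tilted (s Re tr r.ρ))^{⊗E}`,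
`h_e(U) = BalabanAveraging.link (2S+1) B (BlockMean.rep 0) U e`, `H(U) = ∫ g(w·h(U)) dπ(w)` and the
one-link heat-bath laws `ν_ℓ^U`:
`Σ_ℓ ∫∫ (H(U) − H(U[ℓ↦y]))² dν_ℓ^U(y) dμ(U) ≤ K Σ_e ∫∫ (g(w·h(U)) − c_e(w·h(U)))² dπ(w) dμ(U)`.
Instance of `HeatBathSensitivity.sum_integral_sq_sub_le` with the locality of the straight
transporters (`HeatBathSensitivity.link_update_of_not_mem`), their measurability
(`BalabanAveraging.measurable_link`), the path length `width ≤ B` (`BalabanAveraging.width_le`),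
the heat-bath probability laws (`Negative.isProbabilityMeasure_heatBath`) and the Wilson
probability measure (`isProbabilityMeasure_wilsonMeasure`). [folklore] -/
theorem stub_heatBathSensitivity_of :
    (∀ (ι : Type) [Fintype ι] [DecidableEq ι] (K : Type) [Group K] [MeasurableSpace K]
      [MeasurableMul₂ K] (lam : Measure K) [IsProbabilityMeasure lam] [lam.IsMulRightInvariant]
      (ψ : K → ℝ), Measurable ψ → ∀ (Bψ : ℝ), (∀ k, |ψ k| ≤ Bψ) →
      ∀ (Φ : (ι → K) → ℝ), Measurable Φ → (∃ M : ℝ, ∀ w, |Φ w| ≤ M) →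
      ∀ (c : (ι → K) → ℝ), Measurable c → (∃ M : ℝ, ∀ w, |c w| ≤ M) →
      ∀ (e : ι), (∀ w y, c (Function.update w e y) = c w) → ∀ (δ : K),
      (∫ w, Φ w ∂Measure.pi (fun _ : ι => lam.tilted ψ) -
          ∫ w, Φ (Function.update w e (w e * δ)) ∂Measure.pi (fun _ : ι => lam.tilted ψ)) ^ 2 ≤
        4 * Real.exp (4 * Bψ) * ∫ w, (Φ w - c w) ^ 2 ∂Measure.pi (fun _ : ι => lam.tilted ψ)) →
    (∀ (d N B : ℕ) [NeZero N] [NeZero B] (e e' : Edge d (BalabanAveraging.blockSide N B)) (ℓ : Edge d N),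
      ℓ ∈ Literature.MathematicalPhysics.QuantumLattice.pathEdges (BalabanAveraging.corner N B e.1)
        (List.replicate (BalabanAveraging.width N B e.1 e.2) e.2) →
      ℓ ∈ Literature.MathematicalPhysics.QuantumLattice.pathEdges (BalabanAveraging.corner N B e'.1)
        (List.replicate (BalabanAveraging.width N B e'.1 e'.2) e'.2) →
      e = e') →
    ∀ (G : Type) [Group G] [TopologicalSpace G] [IsTopologicalGroup G] [CompactSpace G]
      [MeasurableSpace G] [BorelSpace G] (r : LatticeRep G) (β : ℝ) (B : ℕ) [NeZero B] (s : ℝ), ∃ K : ℝ, ∀ (S : ℕ)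
      (g : GaugeConfig 4 (BalabanAveraging.blockSide (2 * S + 1) B) G → ℝ), Measurable g → (∃ M : ℝ, ∀ V, |g V| ≤ M) →
      ∀ (c : Edge 4 (BalabanAveraging.blockSide (2 * S + 1) B) → GaugeConfig 4 (BalabanAveraging.blockSide (2 * S + 1) B) G → ℝ),
      (∀ e, Measurable (c e)) → (∀ e, ∃ M : ℝ, ∀ V, |c e V| ≤ M) →
      (∀ e V y, c e (Function.update V e y) = c e V) →
      ∑ ℓ : Edge 4 (2 * S + 1), ∫ U, ∫ y,
          ((∫ w, g (fun e => w e * BalabanAveraging.link (2 * S + 1) B (BalabanAveraging.BlockMean.rep 0) U e)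
              ∂Measure.pi (fun _ : Edge 4 (BalabanAveraging.blockSide (2 * S + 1) B) => (haarProbability G).tilted fun w : G => s * (r.ρ w).trace.re)) -
            (∫ w, g (fun e => w e * BalabanAveraging.link (2 * S + 1) B (BalabanAveraging.BlockMean.rep 0) (Function.update U ℓ y) e)
              ∂Measure.pi (fun _ : Edge 4 (BalabanAveraging.blockSide (2 * S + 1) B) => (haarProbability G).tilted fun w : G => s * (r.ρ w).trace.re))) ^ 2
        ∂((haarProbability G).tilted (fun g' => -β * wilsonAction r.ρ (Function.update U ℓ g')))
        ∂(wilsonMeasure r.ρ β : Measure (GaugeConfig 4 (2 * S + 1) G)) ≤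
      K * ∑ e : Edge 4 (BalabanAveraging.blockSide (2 * S + 1) B), ∫ U, ∫ w,
          (g (fun e' => w e' * BalabanAveraging.link (2 * S + 1) B (BalabanAveraging.BlockMean.rep 0) U e') - c e (fun e' => w e' * BalabanAveraging.link (2 * S + 1) B (BalabanAveraging.BlockMean.rep 0) U e')) ^ 2
        ∂Measure.pi (fun _ : Edge 4 (BalabanAveraging.blockSide (2 * S + 1) B) => (haarProbability G).tilted fun w : G => s * (r.ρ w).trace.re)
        ∂(wilsonMeasure r.ρ β : Measure (GaugeConfig 4 (2 * S + 1) G)) := by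
  intro hN5 hN3 G _ _ _ _ _ _ r β B _ s
  haveI : SecondCountableTopology G := Negative.secondCountableTopology_of_latticeRep r
  obtain ⟨Bρ, -, hBρ⟩ := exists_bound_trace_re_nonneg r.ρ r.continuous
  have hψm : Measurable fun w : G => s * (r.ρ w).trace.re :=
    measurable_const.mul (continuous_trace_re r.ρ r.continuous).measurable
  have hψB : ∀ w : G, |s * (r.ρ w).trace.re| ≤ |s| * Bρ := fun w => by
    rw [abs_mul]
    exact mul_le_mul_of_nonneg_left (hBρ w) (abs_nonneg s)
  refine ⟨4 * Real.exp (4 * (|s| * Bρ)) * B, fun S g hg hgM c hc hcM hcu => ?_⟩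
  haveI := isProbabilityMeasure_wilsonMeasure (d := 4) (L := 2 * S + 1) (G := G) r.ρ r.continuous β
  have hlm := BalabanAveraging.measurable_link (d := 4) (N := 2 * S + 1) (b := B) (G := G)
    (BalabanAveraging.BlockMean.rep 0)
  exact HeatBathSensitivity.sum_integral_sq_sub_le hN5 (haarProbability G) hψm hψB
    (wilsonMeasure r.ρ β : Measure (GaugeConfig 4 (2 * S + 1) G))
    (fun (ℓ : Edge 4 (2 * S + 1)) (U : GaugeConfig 4 (2 * S + 1) G) =>
      (haarProbability G).tilted (fun g' => -β * wilsonAction r.ρ (Function.update U ℓ g')))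
    (fun ℓ U => Negative.isProbabilityMeasure_heatBath r β S ℓ U)
    (fun (U : GaugeConfig 4 (2 * S + 1) G) (ℓ : Edge 4 (2 * S + 1)) (y : G) => Function.update U ℓ y)
    (fun (U : GaugeConfig 4 (2 * S + 1) G) (e : Edge 4 (BalabanAveraging.blockSide (2 * S + 1) B)) =>
      BalabanAveraging.link (2 * S + 1) B (BalabanAveraging.BlockMean.rep 0) U e)
    (fun e => (measurable_pi_apply e).comp hlm)
    (fun e => Literature.MathematicalPhysics.QuantumLattice.pathEdges
      (BalabanAveraging.corner (2 * S + 1) B e.1)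
      (List.replicate (BalabanAveraging.width (2 * S + 1) B e.1 e.2) e.2))
    (fun U ℓ y e hℓ => HeatBathSensitivity.link_update_of_not_mem U ℓ y e hℓ)
    (fun e e' ℓ he he' => hN3 4 (2 * S + 1) B e e' ℓ he he')
    (fun e => by
      rw [HeatBathSensitivity.length_pathEdges, List.length_replicate]
      exact BalabanAveraging.width_le _ _)
    hg hgM hc hcM hcu

end Summit.QuantumFields.YangMills.Theorems.SusceptibilityToPoincare.RgVarianceCascade

end
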